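import Literature.NumberTheory.LFunctions.NymanBeurlingRateSmallOrdinates
import Literature.NumberTheory.LFunctions.NymanBeurlingRateMoebiusTail
import HarnessLib

/-!
# Balazard–de Roton 2010, Proposition 10 from Propositions 11, 12 and eq. (t61)

Topic `Literature/NumberTheory/LFunctions`; a brick of the proof of Balazard–de Roton 2010,
Théorème 1 (`Literature.NumberTheory.LFunctions.BalazardDeRoton2010_thm1`, `NymanBeurlingRate.lean`).
M. Balazard, A. de Roton, *Sur un critère de Báez-Duarte pour l'hypothèse de Riemann*, Int. J.
Number Theory 6 (2010) 883–903 = arXiv:0812.1689, §6.3: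

> **Proposition 10.** For `N` large and `ε ≥ 25(log log N)^{5/2+6δ}(log N)^{-1/2}`, for
> `|τ| ≤ N^{3/4}`: `ζ(s+ε)^{-1} − M_N(s+ε) ≪ N^{-ε/4}(1+|τ|)^{1/2−β(τ)}`,
> `β(τ) = log log log(16+|τ|)/(2 log log(16+|τ|))`.

The printed proof combines eq. (t61) (PROVED: `BalazardDeRoton.inv_zeta_sub_moebiusSum_eq`) with
two bounds for the twisted sums `M_t(iτ) = ∑_{n≤t} μ(n)n^{-iτ}`:

* **Proposition 11**, `M_N(iτ) ≪ (1+|τ|)√N exp((log N)^{1/2}(log log N)^{5/2+δ})`, i.e. partial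
  summation (PROVED in general form: `BalazardDeRoton.norm_moebiusSum_twist_le_of_mertens`) from
  the DEEP INPUT `M(x) ≪ √x exp((log x)^{1/2}(log log x)^{5/2+δ})` under RH ([S2008] as refined in
  [BR2008]) — hypothesis `hA` below;
* **Proposition 12**, `M_N(iτ) ≪ √N |τ|^{1/2−κ(τ)}` for
  `exp(3(log N)^{1/2}(log log N)^{5/2+6δ}) ≤ |τ| ≤ N^{3/4}` (Soundararajan's contour with a twist)
  — the second DEEP INPUT, hypothesis `h12` below (`κ = BalazardDeRoton.kappaExp`).

From these two hypotheses this file PROVES the statement of Proposition 10 in the exact form `hP10`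
consumed by `BalazardDeRoton.iBound_of_pointwise` (`NymanBeurlingRateSmallOrdinates.lean`):
`BalazardDeRoton.invZetaApprox_of_deep`. The `ε`-threshold constant is `40` (any constant serves
the theorem; the paper's `25` needs the exponent `1/3` in an intermediate step, we use `1/4`, cf.
`β ≤ 1/4`), and the case distinction at `θ(τ)` of the paper is replaced by adding the two available
bounds pointwise. Nothing is assumed beyond `hA`, `h12` and RH.

## References

* [BalazardDeRoton2010] M. Balazard, A. de Roton, Int. J. Number Theory 6 (2010) 883–903, §6,
  Props. 10–12, eq. (t61) (arXiv:0812.1689 pp. 7–10).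
* [BR2008] M. Balazard, A. de Roton, *Notes de lecture de l'article "Partial sums of the Möbius
  function" de Kannan Soundararajan*, arXiv:0810.3587.
* [S2008] K. Soundararajan, *Partial sums of the Möbius function*, J. reine angew. Math. 631
  (2009), 141–152 (arXiv:0705.0723).
-/

noncomputable section

open Complex Filter Topology Set MeasureTheory Real

namespace Literature.NumberTheory.LFunctions

namespace BalazardDeRoton

open BaezDuarteOnlyIf (moebiusSum)

/-! ## The functions `G_p`, `E_p`, `κ` -/

/-- `E_p(t) = (log t)^{1/2}(log log t)^p`, the exponent in Soundararajan's bound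
`M(x) ≪ √x exp(E_p(x))` (`p = 5/2 + δ`). [cite: BalazardDeRoton2010, §6.1 (C(u))] -/
def eExp (p t : ℝ) : ℝ := (Real.log t) ^ (1 / 2 : ℝ) * (Real.log (Real.log t)) ^ p

/-- `G_p(t) = exp(E_p(t)) = exp((log t)^{1/2}(log log t)^p)`. [cite: BalazardDeRoton2010, §6.1] -/
def gFun (p t : ℝ) : ℝ := Real.exp (eExp p t)

/-- Balazard–de Roton's `κ(τ) = log log log|τ| / (2 log log|τ|)` (Prop. 12).
[cite: BalazardDeRoton2010, Prop. 12] -/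
def kappaExp (τ : ℝ) : ℝ := Real.log (Real.log (Real.log |τ|)) / (2 * Real.log (Real.log |τ|))

/-- `0 < G_p(t)`. [folklore] -/
lemma gFun_pos (p t : ℝ) : 0 < gFun p t := Real.exp_pos _

/-- For `t ≥ 16`: `e < log t`, `1 < log log t`, hence `0 ≤ E_p(t)`. [folklore] -/
lemma log_bounds_of_sixteen_le {t : ℝ} (ht : 16 ≤ t) :
    Real.exp 1 < Real.log t ∧ 1 < Real.log (Real.log t) := by
  have h1 : Real.exp 1 < Real.log t :=
    exp_one_lt_log_sixteen.trans_le (Real.log_le_log (by norm_num) ht)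
  refine ⟨h1, ?_⟩
  rw [← Real.log_exp 1]
  exact Real.log_lt_log (Real.exp_pos 1) h1

/-- `E_p` is non-decreasing on `[16, ∞)` (`p ≥ 0`). [folklore] -/
lemma eExp_mono {p : ℝ} (hp : 0 ≤ p) {t t' : ℝ} (ht : 16 ≤ t) (htt' : t ≤ t') :
    eExp p t ≤ eExp p t' := by
  obtain ⟨h1, h2⟩ := log_bounds_of_sixteen_le ht
  have ht0 : 0 < t := by linarith
  have hL : Real.log t ≤ Real.log t' := Real.log_le_log ht0 htt'
  have hL0 : 0 < Real.log t := (Real.exp_pos 1).trans h1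
  have hLL : Real.log (Real.log t) ≤ Real.log (Real.log t') := Real.log_le_log hL0 hL
  unfold eExp
  exact mul_le_mul (Real.rpow_le_rpow hL0.le hL (by norm_num))
    (Real.rpow_le_rpow (by linarith) hLL hp) (Real.rpow_nonneg (by linarith) _)
    (Real.rpow_nonneg ((Real.exp_pos 1).le.trans (h1.le.trans hL)) _)

/-- `G_p` is non-decreasing on `[16, ∞)` (`p ≥ 0`). [folklore] -/
lemma gFun_mono {p : ℝ} (hp : 0 ≤ p) {t t' : ℝ} (ht : 16 ≤ t) (htt' : t ≤ t') :
    gFun p t ≤ gFun p t' :=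
  Real.exp_le_exp.mpr (eExp_mono hp ht htt')

/-- **`h(t) = E_p(t)/log t = (log log t)^p (log t)^{-1/2}` is non-increasing once
`log log t ≥ 2p`** ("N assez grand"): for `16 ≤ t ≤ t'` with `2p ≤ log log t`,
`E_p(t')/log t' ≤ E_p(t)/log t`. [cite: BalazardDeRoton2010, §6.3 ("pour t ≥ N, (ε/2)log t ≥ …")] -/
lemma eExp_div_log_antitone {p : ℝ} (hp : 0 ≤ p) {t t' : ℝ} (ht : 16 ≤ t) (htt' : t ≤ t')
    (hbig : 2 * p ≤ Real.log (Real.log t)) :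
    eExp p t' / Real.log t' ≤ eExp p t / Real.log t := by
  obtain ⟨h1, h2⟩ := log_bounds_of_sixteen_le ht
  obtain ⟨h1', h2'⟩ := log_bounds_of_sixteen_le (ht.trans htt')
  set v : ℝ := Real.log (Real.log t) with hv
  set v' : ℝ := Real.log (Real.log t') with hv'
  have hL0 : 0 < Real.log t := (Real.exp_pos 1).trans h1
  have hL0' : 0 < Real.log t' := (Real.exp_pos 1).trans h1'
  have hvv' : v ≤ v' := Real.log_le_log hL0 (Real.log_le_log (by linarith) htt')
  have hv0 : 0 < v := by linarith
  -- `E_p(u)/log u = (log log u)^p · exp(−(log log u)/2)`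
  have key : ∀ {u : ℝ}, 16 ≤ u → eExp p u / Real.log u =
      (Real.log (Real.log u)) ^ p * Real.exp (-(Real.log (Real.log u)) / 2) := by
    intro u hu
    obtain ⟨hu1, hu2⟩ := log_bounds_of_sixteen_le hu
    have hLu : 0 < Real.log u := (Real.exp_pos 1).trans hu1
    unfold eExp
    rw [mul_comm, mul_div_assoc]
    congr 1
    rw [div_eq_iff hLu.ne', show -Real.log (Real.log u) / 2 = Real.log (Real.log u) * (-(1 / 2 : ℝ)) by
      ring, ← Real.rpow_def_of_pos hLu]
    conv_rhs => rw [show (Real.log u : ℝ) = Real.log u ^ (1 : ℝ) by rw [Real.rpow_one]]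
    rw [← Real.rpow_mul hLu.le, ← Real.rpow_add hLu]
    norm_num
  rw [key ht, key (ht.trans htt'), ← hv, ← hv']
  -- `v'^p e^{-v'/2} ≤ v^p e^{-v/2}`
  have hquot : (v' / v) ^ p ≤ Real.exp ((v' - v) / 2) := by
    have hq0 : 0 < v' / v := div_pos (by linarith) hv0
    rw [Real.rpow_def_of_pos hq0, Real.exp_le_exp]
    have h1 : Real.log (v' / v) ≤ v' / v - 1 := Real.log_le_sub_one_of_pos hq0
    have h2 : v' / v - 1 = (v' - v) / v := by field_simp
    have h3 : p * ((v' - v) / v) ≤ (v' - v) / 2 := by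
      rw [mul_div_assoc', div_le_div_iff₀ hv0 two_pos]
      nlinarith
    calc Real.log (v' / v) * p ≤ (v' / v - 1) * p := mul_le_mul_of_nonneg_right h1 hp
      _ = p * ((v' - v) / v) := by rw [h2]; ring
      _ ≤ (v' - v) / 2 := h3
  have hsplit : v' ^ p = v ^ p * (v' / v) ^ p := by
    rw [← Real.mul_rpow hv0.le (div_pos (by linarith) hv0).le, mul_div_cancel₀ _ hv0.ne']
  rw [hsplit, mul_assoc]
  refine mul_le_mul_of_nonneg_left ?_ (Real.rpow_nonneg hv0.le _)
  calc (v' / v) ^ p * Real.exp (-v' / 2) ≤ Real.exp ((v' - v) / 2) * Real.exp (-v' / 2) :=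
        mul_le_mul_of_nonneg_right hquot (Real.exp_pos _).le
    _ = Real.exp (-v / 2) := by rw [← Real.exp_add]; congr 1; ring

/-- Consequence: for `N ≥ 16` with `log log N ≥ 2p`, `A · E_p(N)/log N ≤ ε` and `t ≥ N`:
`E_p(t) ≤ (ε/A) log t`, i.e. `G_p(t) ≤ t^{ε/A}` (`A > 0`).
[cite: BalazardDeRoton2010, §6.3 ("(ε/2) log t ≥ (log t)^{1/2}(log log t)^{5/2+δ}")] -/
lemma gFun_le_rpow {p A ε : ℝ} (hp : 0 ≤ p) (hA : 0 < A) {N : ℝ} (hN : 16 ≤ N)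
    (hbig : 2 * p ≤ Real.log (Real.log N)) (hε : A * (eExp p N / Real.log N) ≤ ε) {t : ℝ}
    (ht : N ≤ t) : gFun p t ≤ t ^ (ε / A) := by
  have ht16 : 16 ≤ t := hN.trans ht
  have ht0 : 0 < t := by linarith
  obtain ⟨h1, -⟩ := log_bounds_of_sixteen_le ht16
  have hLt : 0 < Real.log t := (Real.exp_pos 1).trans h1
  have hmono := eExp_div_log_antitone hp hN ht hbig
  have h2 : eExp p t / Real.log t ≤ ε / A := by
    rw [le_div_iff₀ hA]; nlinarith
  unfold gFun
  rw [Real.rpow_def_of_pos ht0, Real.exp_le_exp]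
  rw [div_le_iff₀ hLt] at h2
  linarith

/-! ## `β ≤ 1/4` and `β ≤ κ` for large ordinates -/

/-- `log x ≤ x/2` for `x > 0` (`log x = 2 log √x ≤ 2(√x − 1) ≤ x/2`). [folklore] -/
lemma log_le_half {x : ℝ} (hx : 0 < x) : Real.log x ≤ x / 2 := by
  have hs := Real.sqrt_pos.mpr hx
  have h1 : Real.log x = 2 * Real.log (Real.sqrt x) := by
    rw [Real.log_sqrt hx.le]; ring
  have h2 : Real.log (Real.sqrt x) ≤ Real.sqrt x - 1 := Real.log_le_sub_one_of_pos hs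
  have h3 : Real.sqrt x * Real.sqrt x = x := Real.mul_self_sqrt hx.le
  nlinarith [sq_nonneg (Real.sqrt x - 2)]

/-- `β(τ) ≤ 1/4`. [folklore] -/
lemma betaExp_le_quarter (τ : ℝ) : betaExp τ ≤ 1 / 4 := by
  obtain ⟨-, h2, -⟩ := log_sixteen_add_bounds τ
  unfold betaExp
  rw [div_le_iff₀ (by positivity)]
  have := log_le_half (by linarith : 0 < Real.log (Real.log (16 + |τ|)))
  linarith

/-- `φ(w) = log w / w` is non-increasing on `[e, ∞)`. [folklore] -/
lemma log_div_self_antitone {w w' : ℝ} (hw : Real.exp 1 ≤ w) (hww' : w ≤ w') :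
    Real.log w' / w' ≤ Real.log w / w := by
  have hw0 : 0 < w := (Real.exp_pos 1).trans_le hw
  have hw0' : 0 < w' := hw0.trans_le hww'
  have hlw : 1 ≤ Real.log w := by
    rw [← Real.log_exp 1]; exact Real.log_le_log (Real.exp_pos 1) hw
  rw [div_le_div_iff₀ hw0' hw0]
  have h1 : Real.log w' = Real.log w + Real.log (w' / w) := by
    rw [← Real.log_mul hw0.ne' (div_pos hw0' hw0).ne', mul_div_cancel₀ _ hw0.ne']
  have h2 : Real.log (w' / w) ≤ w' / w - 1 := Real.log_le_sub_one_of_pos (div_pos hw0' hw0)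
  have h3 : w * (w' / w - 1) = w' - w := by field_simp
  rw [h1]
  nlinarith [mul_le_mul_of_nonneg_left h2 hw0.le]

/-- **`β(τ) ≤ κ(τ)` for `|τ| ≥ exp(e^e)`**: both are `φ(log log ·)/2` with `φ(w) = log w/w`
non-increasing beyond `e`, and `log log |τ| ≤ log log(16+|τ|)`.
[cite: BalazardDeRoton2010, §6.3 ("pour |τ| grand, β(τ) − κ(τ) ≪ 1/log|τ|")] -/
lemma betaExp_le_kappaExp {τ : ℝ} (hτ : Real.exp (Real.exp (Real.exp 1)) ≤ |τ|) :
    betaExp τ ≤ kappaExp τ := by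
  have hτ0 : 0 < |τ| := (Real.exp_pos _).trans_le hτ
  have hL : Real.exp (Real.exp 1) ≤ Real.log |τ| := by
    rw [← Real.log_exp (Real.exp (Real.exp 1))]; exact Real.log_le_log (Real.exp_pos _) hτ
  have hL0 : 0 < Real.log |τ| := (Real.exp_pos _).trans_le hL
  have hLL : Real.exp 1 ≤ Real.log (Real.log |τ|) := by
    rw [← Real.log_exp (Real.exp 1)]; exact Real.log_le_log (Real.exp_pos _) hL
  have hL' : Real.log |τ| ≤ Real.log (16 + |τ|) := Real.log_le_log hτ0 (by linarith)
  have hLL' : Real.log (Real.log |τ|) ≤ Real.log (Real.log (16 + |τ|)) := Real.log_le_log hL0 hL'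
  have := log_div_self_antitone hLL hLL'
  unfold betaExp kappaExp
  have hpos1 : 0 < Real.log (Real.log (16 + |τ|)) := (Real.exp_pos 1).trans_le (hLL.trans hLL')
  have hpos2 : 0 < Real.log (Real.log |τ|) := (Real.exp_pos 1).trans_le hLL
  rw [div_le_div_iff₀ (by positivity) (by positivity)]
  rw [div_le_div_iff₀ hpos1 hpos2] at this
  nlinarith

/-! ## The engine: eq. (t61) with a bound `|M_t(iτ)| ≤ U√t + V√t·t^{ε/6}` -/

/-- `∫_N^∞ t^{-1-r} dt = N^{-r}/r` bound: for `r > 0`, `N > 0`, `∫_{(N,∞)} t^{-1-r} ≤ N^{-r}/r`.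
[folklore] -/
lemma integral_Ioi_rpow_neg_le {r N : ℝ} (hr : 0 < r) (hN : 0 < N) :
    IntegrableOn (fun t : ℝ ↦ t ^ (-1 - r)) (Set.Ioi N) ∧
      ∫ t in Set.Ioi N, t ^ (-1 - r) = N ^ (-r) / r := by
  refine ⟨integrableOn_Ioi_rpow_of_lt (by linarith) hN, ?_⟩
  rw [integral_Ioi_rpow_of_lt (by linarith) hN]
  rw [show (-1 - r + 1 : ℝ) = -r by ring]
  field_simp

/-- **The engine.** Under RH, for `N ≥ 1`, `0 < ε ≤ 1/4`, `ε⁻¹ ≤ N^{ε/6}` and a bound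
`|M_{⌊t⌋}(iτ)| ≤ U√t + V√t·t^{ε/6}` for all real `t ≥ N` (`U, V ≥ 0`), eq. (t61) gives
`|ζ(s+ε)^{-1} − M_N(s+ε)| ≤ (2U + 3V) N^{-2ε/3}`. [cite: BalazardDeRoton2010, §6.3] -/
theorem norm_inv_zeta_sub_moebiusSum_le (hRH : RiemannHypothesis) {N : ℕ} (hN : 1 ≤ N)
    {ε : ℝ} (hε : 0 < ε) (hε1 : ε ≤ 1 / 4) (hεN : ε⁻¹ ≤ (N : ℝ) ^ (ε / 6)) (τ : ℝ) {U V : ℝ}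
    (hU : 0 ≤ U) (hV : 0 ≤ V)
    (hUV : ∀ t : ℝ, (N : ℝ) ≤ t →
      ‖moebiusSum ⌊t⌋₊ (τ * I)‖ ≤ U * Real.sqrt t + V * Real.sqrt t * t ^ (ε / 6)) :
    ‖(riemannZeta (1 / 2 + ε + τ * I))⁻¹ - moebiusSum N (1 / 2 + ε + τ * I)‖ ≤
      (2 * U + 3 * V) * (N : ℝ) ^ (-(2 * ε / 3)) := by
  obtain ⟨hgi, heq⟩ := inv_zeta_sub_moebiusSum_eq hRH hN hε hε1 τ
  set a : ℝ := 1 / 2 + ε with ha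
  have ha0 : 0 < a := by positivity
  have ha1 : a ≤ 3 / 4 := by rw [ha]; linarith
  have hN1 : (1 : ℝ) ≤ N := by exact_mod_cast hN
  have hN0 : (0 : ℝ) < N := by linarith
  rw [heq]
  -- the boundary term
  have hnormN : ‖((N : ℝ) : ℂ) ^ (-((1 / 2 + ε : ℝ) : ℂ))‖ = (N : ℝ) ^ (-a) := by
    rw [Complex.norm_cpow_eq_rpow_re_of_pos hN0]; simp [ha]
  have hsqrtN : Real.sqrt N = (N : ℝ) ^ (1 / 2 : ℝ) := Real.sqrt_eq_rpow _
  have hMN := hUV N le_rfl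
  rw [Nat.floor_natCast] at hMN
  have hterm1 : ‖-(moebiusSum N (τ * I) * ((N : ℝ) : ℂ) ^ (-((1 / 2 + ε : ℝ) : ℂ)))‖ ≤
      U * (N : ℝ) ^ (-ε) + V * (N : ℝ) ^ (-(5 * ε / 6)) := by
    rw [norm_neg, norm_mul, hnormN]
    calc ‖moebiusSum N (τ * I)‖ * (N : ℝ) ^ (-a)
        ≤ (U * Real.sqrt N + V * Real.sqrt N * (N : ℝ) ^ (ε / 6)) * (N : ℝ) ^ (-a) :=
          mul_le_mul_of_nonneg_right hMN (Real.rpow_nonneg hN0.le _)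
      _ = U * ((N : ℝ) ^ (1 / 2 : ℝ) * (N : ℝ) ^ (-a)) +
            V * ((N : ℝ) ^ (1 / 2 : ℝ) * (N : ℝ) ^ (ε / 6) * (N : ℝ) ^ (-a)) := by rw [hsqrtN]; ring
      _ = U * (N : ℝ) ^ (-ε) + V * (N : ℝ) ^ (-(5 * ε / 6)) := by
          rw [← Real.rpow_add hN0, ← Real.rpow_add hN0, ← Real.rpow_add hN0]
          congr 2 <;> (congr 1; rw [ha]; ring)
  -- the integral term
  set g : ℝ → ℂ := fun t ↦ (t : ℂ) ^ (-((1 / 2 + ε : ℝ) : ℂ) - 1) * moebiusSum ⌊t⌋₊ (τ * I) with hg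
  obtain ⟨hI1, hI1v⟩ := integral_Ioi_rpow_neg_le hε hN0
  obtain ⟨hI2, hI2v⟩ := integral_Ioi_rpow_neg_le (by positivity : 0 < 5 * ε / 6) hN0
  have hbound : ∀ t ∈ Set.Ioi (N : ℝ), ‖g t‖ ≤ U * t ^ (-1 - ε) + V * t ^ (-1 - 5 * ε / 6) := by
    intro t ht
    have ht' : (N : ℝ) ≤ t := le_of_lt ht
    have ht0 : 0 < t := hN0.trans ht
    have hb := hUV t ht'
    rw [Real.sqrt_eq_rpow] at hb
    simp only [hg, norm_mul]
    rw [Complex.norm_cpow_eq_rpow_re_of_pos ht0]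
    have hre : (-((1 / 2 + ε : ℝ) : ℂ) - 1).re = -a - 1 := by simp [ha]
    rw [hre]
    have e1 : t ^ (-a - 1) * t ^ (1 / 2 : ℝ) = t ^ (-1 - ε) := by
      rw [← Real.rpow_add ht0]; congr 1; rw [ha]; ring
    have e2 : t ^ (-1 - ε) * t ^ (ε / 6) = t ^ (-1 - 5 * ε / 6) := by
      rw [← Real.rpow_add ht0]; congr 1; ring
    calc t ^ (-a - 1) * ‖moebiusSum ⌊t⌋₊ (τ * I)‖
        ≤ t ^ (-a - 1) * (U * t ^ (1 / 2 : ℝ) + V * t ^ (1 / 2 : ℝ) * t ^ (ε / 6)) :=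
          mul_le_mul_of_nonneg_left hb (Real.rpow_nonneg ht0.le _)
      _ = U * (t ^ (-a - 1) * t ^ (1 / 2 : ℝ)) + V * ((t ^ (-a - 1) * t ^ (1 / 2 : ℝ)) * t ^ (ε / 6)) := by
          ring
      _ = U * t ^ (-1 - ε) + V * t ^ (-1 - 5 * ε / 6) := by rw [e1, e2]
  have hterm2 : ‖∫ t in Set.Ioi (N : ℝ), g t‖ ≤ U * ((N : ℝ) ^ (-ε) / ε) +
      V * ((N : ℝ) ^ (-(5 * ε / 6)) / (5 * ε / 6)) := by
    calc ‖∫ t in Set.Ioi (N : ℝ), g t‖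
        ≤ ∫ t in Set.Ioi (N : ℝ), (U * t ^ (-1 - ε) + V * t ^ (-1 - 5 * ε / 6)) :=
          norm_integral_le_of_norm_le ((hI1.const_mul U).add (hI2.const_mul V))
            (ae_restrict_of_forall_mem measurableSet_Ioi hbound)
      _ = U * ((N : ℝ) ^ (-ε) / ε) + V * ((N : ℝ) ^ (-(5 * ε / 6)) / (5 * ε / 6)) := by
          rw [integral_add (hI1.const_mul U) (hI2.const_mul V), integral_const_mul,
            integral_const_mul, hI1v, hI2v]
  -- powers of `N`: everything is `≤ N^{-2ε/3}` after `ε⁻¹ ≤ N^{ε/6}`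
  have hp1 : (N : ℝ) ^ (-ε) ≤ (N : ℝ) ^ (-(2 * ε / 3)) :=
    Real.rpow_le_rpow_of_exponent_le hN1 (by linarith)
  have hp2 : (N : ℝ) ^ (-(5 * ε / 6)) ≤ (N : ℝ) ^ (-(2 * ε / 3)) :=
    Real.rpow_le_rpow_of_exponent_le hN1 (by linarith)
  have hp3 : (N : ℝ) ^ (-ε) / ε ≤ (N : ℝ) ^ (-(2 * ε / 3)) := by
    rw [div_eq_mul_inv]
    calc (N : ℝ) ^ (-ε) * ε⁻¹ ≤ (N : ℝ) ^ (-ε) * (N : ℝ) ^ (ε / 6) :=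
          mul_le_mul_of_nonneg_left hεN (Real.rpow_nonneg hN0.le _)
      _ = (N : ℝ) ^ (-(5 * ε / 6)) := by rw [← Real.rpow_add hN0]; congr 1; ring
      _ ≤ _ := hp2
  have hp4 : (N : ℝ) ^ (-(5 * ε / 6)) / (5 * ε / 6) ≤ 2 * (N : ℝ) ^ (-(2 * ε / 3)) := by
    rw [div_eq_mul_inv, show (5 * ε / 6)⁻¹ = (6 / 5) * ε⁻¹ by field_simp]
    calc (N : ℝ) ^ (-(5 * ε / 6)) * (6 / 5 * ε⁻¹) ≤ (N : ℝ) ^ (-(5 * ε / 6)) * (6 / 5 * (N : ℝ) ^ (ε / 6)) := by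
          gcongr
      _ = 6 / 5 * ((N : ℝ) ^ (-(5 * ε / 6)) * (N : ℝ) ^ (ε / 6)) := by ring
      _ = 6 / 5 * (N : ℝ) ^ (-(2 * ε / 3)) := by rw [← Real.rpow_add hN0]; congr 2; ring
      _ ≤ 2 * (N : ℝ) ^ (-(2 * ε / 3)) := by gcongr; norm_num
  have ha' : ‖((1 / 2 + ε : ℝ) : ℂ)‖ ≤ 1 := by
    rw [Complex.norm_real, Real.norm_of_nonneg ha0.le]; linarith
  set P : ℝ := (N : ℝ) ^ (-(2 * ε / 3)) with hP
  have hP0 : 0 ≤ P := Real.rpow_nonneg hN0.le _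
  calc ‖-(moebiusSum N (τ * I) * ((N : ℝ) : ℂ) ^ (-((1 / 2 + ε : ℝ) : ℂ))) +
        ((1 / 2 + ε : ℝ) : ℂ) * ∫ t in Set.Ioi (N : ℝ), g t‖
      ≤ ‖-(moebiusSum N (τ * I) * ((N : ℝ) : ℂ) ^ (-((1 / 2 + ε : ℝ) : ℂ)))‖ +
        ‖((1 / 2 + ε : ℝ) : ℂ)‖ * ‖∫ t in Set.Ioi (N : ℝ), g t‖ := by
          refine (norm_add_le _ _).trans (add_le_add le_rfl ?_); rw [norm_mul]
    _ ≤ (U * (N : ℝ) ^ (-ε) + V * (N : ℝ) ^ (-(5 * ε / 6))) +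
        1 * (U * ((N : ℝ) ^ (-ε) / ε) + V * ((N : ℝ) ^ (-(5 * ε / 6)) / (5 * ε / 6))) := by
          gcongr
    _ ≤ (U * P + V * P) + (U * P + V * (2 * P)) := by
          rw [one_mul]; gcongr
    _ = (2 * U + 3 * V) * P := by ring

/-! ## From Soundararajan's bound to a bound on `[1, ∞)` with a monotone majorant -/

/-- The majorant `G̃(t) = G_p(max(t,16))` is `≥ 1`. [folklore] -/
lemma one_le_gFun_max (p t : ℝ) : 1 ≤ gFun p (max t 16) := by
  unfold gFun eExp
  obtain ⟨h1, h2⟩ := log_bounds_of_sixteen_le (le_max_right t 16)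
  exact Real.one_le_exp (mul_nonneg (Real.rpow_nonneg ((Real.exp_pos 1).le.trans h1.le) _)
    (Real.rpow_nonneg (by linarith) _))

/-- `G̃` is non-decreasing on `[1, ∞)`. [folklore] -/
lemma gFun_max_monotoneOn {p : ℝ} (hp : 0 ≤ p) :
    MonotoneOn (fun t : ℝ ↦ gFun p (max t 16)) (Set.Ici 1) :=
  fun _ _ _ _ htt' ↦ gFun_mono hp (le_max_right _ _) (max_le_max htt' le_rfl)

/-- From `|M(x)| ≤ C√x G_p(x)` (`x ≥ 3`) to `|M(x)| ≤ max(C,4) √x G̃(x)` for all `x ≥ 1`. [folklore] -/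
lemma abs_mertens_le_gFun_max {p C : ℝ}
    (hM : ∀ x : ℝ, 3 ≤ x → |(mertensFunction x : ℝ)| ≤ C * Real.sqrt x * gFun p x) (x : ℝ)
    (hx : 1 ≤ x) : |(mertensFunction x : ℝ)| ≤ max C 4 * Real.sqrt x * gFun p (max x 16) := by
  have hG1 := one_le_gFun_max p x
  have hG0 : 0 ≤ gFun p (max x 16) := zero_le_one.trans hG1
  rcases le_or_gt 16 x with h16 | h16
  · rw [max_eq_left h16] at hG0 ⊢
    refine (hM x (by linarith)).trans ?_
    exact mul_le_mul_of_nonneg_right (mul_le_mul_of_nonneg_right (le_max_left _ _)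
      (Real.sqrt_nonneg _)) hG0
  · have hx0 : 0 ≤ x := by linarith
    have hsqrt : Real.sqrt x ≤ 4 := by
      rw [show (4 : ℝ) = Real.sqrt 16 by
        rw [show (16 : ℝ) = 4 ^ 2 by norm_num, Real.sqrt_sq (by norm_num)]]
      exact Real.sqrt_le_sqrt h16.le
    have hs0 := Real.sqrt_nonneg x
    calc |(mertensFunction x : ℝ)| ≤ x := abs_mertens_le hx0
      _ = Real.sqrt x * Real.sqrt x := (Real.mul_self_sqrt hx0).symm
      _ ≤ 4 * Real.sqrt x * 1 := by nlinarith
      _ ≤ max C 4 * Real.sqrt x * gFun p (max x 16) :=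
          mul_le_mul (mul_le_mul_of_nonneg_right (le_max_right _ _) hs0) hG1 zero_le_one
            (by positivity)

/-! ## Elementary steps of §6.3 -/

/-- `E_p(N)/log N = (log log N)^p (log N)^{-1/2}` (`log N > 0`). [folklore] -/
lemma eExp_div_log_eq {p N : ℝ} (hN : 0 < Real.log N) :
    eExp p N / Real.log N = Real.log (Real.log N) ^ p * Real.log N ^ (-(1 / 2 : ℝ)) := by
  unfold eExp
  rw [mul_comm, mul_div_assoc, show (-(1 / 2 : ℝ)) = 1 / 2 - 1 by norm_num,
    Real.rpow_sub_one hN.ne']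

/-- `κ(τ) ≤ 1/2` when `log log |τ| > 0`. [folklore] -/
lemma kappaExp_le_half {τ : ℝ} (h : 0 < Real.log (Real.log |τ|)) : kappaExp τ ≤ 1 / 2 := by
  unfold kappaExp
  rw [div_le_iff₀ (by positivity)]
  have := Real.log_le_sub_one_of_pos h
  linarith

/-- **`ε⁻¹ ≤ N^{ε/6}`** from `(log N)^{1/2} ≤ E`, `40E ≤ ε log N` (`ε > 0`, `N > 1`).
[cite: BalazardDeRoton2010, §6.3 ("ε⁻¹ ≤ … ≤ N^{ε/6}")] -/
lemma inv_eps_le_rpow {N ε E : ℝ} (hN : 0 < N) (hL : 0 < Real.log N) (hε : 0 < ε)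
    (hE1 : Real.log N ^ (1 / 2 : ℝ) ≤ E) (hE : 40 * E ≤ ε * Real.log N) :
    ε⁻¹ ≤ N ^ (ε / 6) := by
  set R : ℝ := Real.log N ^ (1 / 2 : ℝ) with hR
  have hR0 : 0 < R := Real.rpow_pos_of_pos hL _
  have hRR : R * R = Real.log N := by
    rw [hR, ← Real.rpow_add hL]; norm_num
  have h40 : 40 ≤ ε * R := by
    have h1 : 40 * R ≤ (ε * R) * R := by rw [mul_assoc, hRR]; linarith
    exact le_of_mul_le_mul_right h1 hR0
  have h1 : ε⁻¹ ≤ R := by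
    rw [inv_le_iff_one_le_mul₀ hε]; nlinarith
  have h2 : R ≤ N ^ (ε / 6) := by
    rw [Real.rpow_def_of_pos hN]
    calc R ≤ E := hE1
      _ ≤ E + 1 := by linarith
      _ ≤ Real.exp E := Real.add_one_le_exp E
      _ ≤ Real.exp (Real.log N * (ε / 6)) := Real.exp_le_exp.mpr (by nlinarith)
  exact h1.trans h2

/-- **Small ordinates, the exponent trade**: from `1 ≤ B`, `log B ≤ 4E`, `0 ≤ E`, `40E ≤ ε log N`:
`B N^{-2ε/3} ≤ B^{1/4} N^{-ε/4}`. [cite: BalazardDeRoton2010, §6.3 ("(1+|τ|)N^{-ε/3} ≪ (1+|τ|)^{1/3}N^{-ε/4}")] -/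
lemma mul_rpow_le_rpow_mul_rpow {B N ε E : ℝ} (hB : 1 ≤ B) (hN : 0 < N) (hE0 : 0 ≤ E)
    (hlogB : Real.log B ≤ 4 * E) (hE : 40 * E ≤ ε * Real.log N) :
    B * N ^ (-(2 * ε / 3)) ≤ B ^ (1 / 4 : ℝ) * N ^ (-ε / 4) := by
  have hB0 : 0 < B := by linarith
  have h1 : B ^ (3 / 4 : ℝ) ≤ N ^ (5 * ε / 12) := by
    rw [Real.rpow_def_of_pos hB0, Real.rpow_def_of_pos hN, Real.exp_le_exp]
    nlinarith
  calc B * N ^ (-(2 * ε / 3)) = B ^ (1 / 4 : ℝ) * (B ^ (3 / 4 : ℝ) * N ^ (-(2 * ε / 3))) := by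
        rw [← mul_assoc, ← Real.rpow_add hB0]; norm_num
    _ ≤ B ^ (1 / 4 : ℝ) * (N ^ (5 * ε / 12) * N ^ (-(2 * ε / 3))) := by gcongr
    _ = B ^ (1 / 4 : ℝ) * N ^ (-ε / 4) := by rw [← Real.rpow_add hN]; congr 2; ring

/-- **Large ordinates, final algebra**: from `‖R‖ ≤ (2K₁₂ q + 6K₁) P` with `1 ≤ q ≤ Q`,
`P ≤ P'`, everything non-negative: `‖R‖ ≤ (2K₁₂ + 6K₁ + 1) P' Q`. [folklore] -/
lemma large_final_algebra {R K₁₂ K₁ q Q P P' : ℝ} (hK₁₂ : 0 ≤ K₁₂) (hK₁ : 0 ≤ K₁)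
    (hR : R ≤ (2 * (K₁₂ * q) + 3 * (2 * K₁)) * P) (hq1 : 1 ≤ q) (hqQ : q ≤ Q) (hP : 0 ≤ P)
    (hPP' : P ≤ P') : R ≤ (2 * K₁₂ + 6 * K₁ + 1) * P' * Q := by
  have hq0 : 0 ≤ q := by linarith
  have hP'0 : 0 ≤ P' := hP.trans hPP'
  calc R ≤ (2 * (K₁₂ * q) + 3 * (2 * K₁)) * P := hR
    _ ≤ (2 * (K₁₂ * q) + 6 * K₁ * q) * P := by
        apply mul_le_mul_of_nonneg_right _ hP; nlinarith
    _ = (2 * K₁₂ + 6 * K₁) * P * q := by ring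
    _ ≤ (2 * K₁₂ + 6 * K₁ + 1) * P' * Q :=
        mul_le_mul (mul_le_mul (by linarith) hPP' hP (by positivity)) hqQ hq0
          (mul_nonneg (by positivity) hP'0)

/-! ## The two cases of §6.3 -/

/-- **Small ordinates** (`|τ| ≤ exp(3E)`): from Prop. 11's pointwise bound and the engine,
`|ζ(s+ε)^{-1} − M_N(s+ε)| ≤ 3K₁ N^{-ε/4}(1+|τ|)^{1/2−β(τ)}`.
[cite: BalazardDeRoton2010, §6.3 ("Petites valeurs de |τ|")] -/
lemma small_case (hRH : RiemannHypothesis) {N : ℕ} (hN : 1 ≤ N) {ε : ℝ} (hε : 0 < ε)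
    (hε1 : ε ≤ 1 / 4) (hεN : ε⁻¹ ≤ (N : ℝ) ^ (ε / 6)) {τ K₁ E : ℝ} (hK₁ : 0 ≤ K₁)
    (h11 : ∀ t : ℝ, (N : ℝ) ≤ t →
      ‖moebiusSum ⌊t⌋₊ (τ * I)‖ ≤ K₁ * (1 + |τ|) * Real.sqrt t * t ^ (ε / 6))
    (hE0 : 0 ≤ E) (hlogτ : Real.log (1 + |τ|) ≤ 4 * E) (hE : 40 * E ≤ ε * Real.log N) :
    ‖(riemannZeta (1 / 2 + ε + τ * I))⁻¹ - moebiusSum N (1 / 2 + ε + τ * I)‖ ≤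
      3 * K₁ * (N : ℝ) ^ (-ε / 4) * (1 + |τ|) ^ (1 / 2 - betaExp τ) := by
  have hN0 : (0 : ℝ) < N := by exact_mod_cast (show 0 < N by omega)
  have hbase : 1 ≤ 1 + |τ| := by linarith [abs_nonneg τ]
  have hR := norm_inv_zeta_sub_moebiusSum_le hRH hN hε hε1 hεN τ le_rfl
    (by positivity : 0 ≤ K₁ * (1 + |τ|)) (fun t ht ↦ by
      have := h11 t ht; linarith [this])
  have hkey := mul_rpow_le_rpow_mul_rpow hbase hN0 hE0 hlogτ hE
  have hexp : (1 + |τ|) ^ (1 / 4 : ℝ) ≤ (1 + |τ|) ^ (1 / 2 - betaExp τ) :=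
    Real.rpow_le_rpow_of_exponent_le hbase (by linarith [betaExp_le_quarter τ])
  have hNpos : 0 ≤ (N : ℝ) ^ (-ε / 4) := Real.rpow_nonneg hN0.le _
  calc ‖(riemannZeta (1 / 2 + ε + τ * I))⁻¹ - moebiusSum N (1 / 2 + ε + τ * I)‖
      ≤ (2 * 0 + 3 * (K₁ * (1 + |τ|))) * (N : ℝ) ^ (-(2 * ε / 3)) := hR
    _ = 3 * K₁ * ((1 + |τ|) * (N : ℝ) ^ (-(2 * ε / 3))) := by ring
    _ ≤ 3 * K₁ * ((1 + |τ|) ^ (1 / 4 : ℝ) * (N : ℝ) ^ (-ε / 4)) :=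
        mul_le_mul_of_nonneg_left hkey (by positivity)
    _ ≤ 3 * K₁ * ((1 + |τ|) ^ (1 / 2 - betaExp τ) * (N : ℝ) ^ (-ε / 4)) :=
        mul_le_mul_of_nonneg_left (mul_le_mul_of_nonneg_right hexp hNpos) (by positivity)
    _ = 3 * K₁ * (N : ℝ) ^ (-ε / 4) * (1 + |τ|) ^ (1 / 2 - betaExp τ) := by ring

/-- **Large ordinates, pointwise**: with `q = |τ|^{1/2−κ(τ)}`, if Prop. 12 (at the lengths
`X ≥ N` for which its threshold `exp(3E_p(X)) = G̃(X)³ ≤ |τ|`) and Prop. 11 (elsewhere, where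
`1+|τ| ≤ 2|τ| < 2G̃(X)³`) are available, then for all real `t ≥ N`:
`|M_{⌊t⌋}(iτ)| ≤ K₁₂ q √t + 2K₁ √t · t^{ε/6}`. [cite: BalazardDeRoton2010, §6.3 ("Grandes valeurs de |τ|")] -/
lemma large_pointwise {p : ℝ} (hp : 0 ≤ p) {N : ℕ} (hN16 : 16 ≤ N) {ε τ K₁ K₁₂ q : ℝ}
    (hK₁ : 0 ≤ K₁) (hK₁₂ : 0 ≤ K₁₂) (hq : 0 ≤ q) (hτ1 : 1 ≤ |τ|) (hτN : |τ| ≤ (N : ℝ) ^ (3 / 4 : ℝ))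
    (h11 : ∀ X : ℕ, 1 ≤ X → ‖moebiusSum X (τ * I)‖ ≤ K₁ * (1 + |τ|) * Real.sqrt X * gFun p (max X 16))
    (h12 : ∀ X : ℕ, N ≤ X → Real.exp (3 * eExp p X) ≤ |τ| → |τ| ≤ (X : ℝ) ^ (3 / 4 : ℝ) →
      ‖moebiusSum X (τ * I)‖ ≤ K₁₂ * Real.sqrt X * q)
    (hG4 : ∀ t : ℝ, (N : ℝ) ≤ t → gFun p (max t 16) ^ 4 ≤ t ^ (ε / 6)) {t : ℝ} (ht : (N : ℝ) ≤ t) :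
    ‖moebiusSum ⌊t⌋₊ (τ * I)‖ ≤ K₁₂ * q * Real.sqrt t + 2 * K₁ * Real.sqrt t * t ^ (ε / 6) := by
  have hN16' : (16 : ℝ) ≤ N := by exact_mod_cast hN16
  have hN0 : (0 : ℝ) < N := by linarith
  have ht0 : 0 ≤ t := by linarith
  have ht1 : 1 ≤ t := le_trans (by linarith) ht
  set X : ℕ := ⌊t⌋₊ with hX
  have hXN : N ≤ X := Nat.le_floor ht
  have hX1 : 1 ≤ X := le_trans (by omega) hXN
  have hXt : (X : ℝ) ≤ t := Nat.floor_le ht0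
  have hX16 : (16 : ℝ) ≤ X := hN16'.trans (by exact_mod_cast hXN)
  have hX1' : (1 : ℝ) ≤ X := by linarith
  have hsqrt : Real.sqrt X ≤ Real.sqrt t := Real.sqrt_le_sqrt hXt
  have hGm := gFun_max_monotoneOn hp (Set.mem_Ici.mpr hX1') (Set.mem_Ici.mpr ht1) hXt
  simp only at hGm
  have hG1t := one_le_gFun_max p t
  have hpos1 : 0 ≤ K₁₂ * q * Real.sqrt t := by positivity
  have hpos2 : 0 ≤ 2 * K₁ * Real.sqrt t * t ^ (ε / 6) := by positivity
  rcases le_or_gt (Real.exp (3 * eExp p X)) |τ| with hcase | hcase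
  · have hτX : |τ| ≤ (X : ℝ) ^ (3 / 4 : ℝ) :=
      hτN.trans (Real.rpow_le_rpow hN0.le (by exact_mod_cast hXN) (by norm_num))
    calc ‖moebiusSum X (τ * I)‖ ≤ K₁₂ * Real.sqrt X * q := h12 X hXN hcase hτX
      _ ≤ K₁₂ * Real.sqrt t * q := by gcongr
      _ = K₁₂ * q * Real.sqrt t := by ring
      _ ≤ _ := le_add_of_nonneg_right hpos2
  · have hGX : Real.exp (3 * eExp p X) = gFun p (max X 16) ^ 3 := by
      rw [max_eq_left hX16, gFun, ← Real.exp_nat_mul]; norm_num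
    have hτG : 1 + |τ| ≤ 2 * gFun p (max t 16) ^ 3 := by
      have h1 : |τ| ≤ gFun p (max t 16) ^ 3 := by
        rw [hGX] at hcase
        exact hcase.le.trans (pow_le_pow_left₀ (zero_le_one.trans (one_le_gFun_max p X)) hGm 3)
      linarith
    calc ‖moebiusSum X (τ * I)‖ ≤ K₁ * (1 + |τ|) * Real.sqrt X * gFun p (max X 16) := h11 X hX1
      _ ≤ K₁ * (2 * gFun p (max t 16) ^ 3) * Real.sqrt t * gFun p (max t 16) := by
          gcongr; exact zero_le_one.trans (one_le_gFun_max p X)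
      _ = 2 * K₁ * Real.sqrt t * gFun p (max t 16) ^ 4 := by ring
      _ ≤ 2 * K₁ * Real.sqrt t * t ^ (ε / 6) := by gcongr; exact hG4 t ht
      _ ≤ _ := le_add_of_nonneg_left hpos1

/-! ## Proposition 10 from the deep inputs -/

/-- **Balazard–de Roton 2010, Proposition 10, from the deep inputs.** Assume RH and
(A) Soundararajan's bound as refined in [BR2008]: for every `0 < δ ≤ 1/2` there is `C` with
  `|M(x)| ≤ C√x exp((log x)^{1/2}(log log x)^{5/2+δ})` for `x ≥ 3`;
(P12) Proposition 12: for every `0 < δ ≤ 1/12` there are `N₀, K` with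
  `|M_N(iτ)| ≤ K√N |τ|^{1/2−κ(τ)}` for `N ≥ N₀`, `exp(3(log N)^{1/2}(log log N)^{5/2+6δ}) ≤ |τ| ≤ N^{3/4}`.
Then Proposition 10 holds in the form `hP10` of `iBound_of_pointwise`: for every `0 < δ ≤ 1/2`
there are `A, K, N₀` with `|ζ(s+ε)^{-1} − M_N(s+ε)| ≤ K N^{-ε/4}(1+|τ|)^{1/2−β(τ)}` whenever
`N ≥ N₀`, `A(log log N)^{5/2+δ}(log N)^{-1/2} ≤ ε ≤ 1/4`, `|τ| ≤ N^{3/4}` (here `A = 40`).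
[cite: BalazardDeRoton2010, Prop. 10 (proof, §6.3)] -/
theorem invZetaApprox_of_deep (hRH : RiemannHypothesis)
    (hA : ∀ δ : ℝ, 0 < δ → δ ≤ 1 / 2 → ∃ C : ℝ, 0 < C ∧ ∀ x : ℝ, 3 ≤ x →
      |(mertensFunction x : ℝ)| ≤ C * Real.sqrt x * gFun (5 / 2 + δ) x)
    (h12 : ∀ δ : ℝ, 0 < δ → δ ≤ 1 / 12 → ∃ (N₀ : ℕ) (K : ℝ), 0 < K ∧ ∀ N : ℕ, N₀ ≤ N →
      ∀ τ : ℝ, Real.exp (3 * eExp (5 / 2 + 6 * δ) N) ≤ |τ| → |τ| ≤ (N : ℝ) ^ (3 / 4 : ℝ) →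
        ‖moebiusSum N (τ * I)‖ ≤ K * Real.sqrt N * |τ| ^ (1 / 2 - kappaExp τ)) :
    ∀ δ : ℝ, 0 < δ → δ ≤ 1 / 2 → ∃ (A K : ℝ) (N₀ : ℕ), 0 < A ∧ 0 < K ∧
      ∀ N : ℕ, N₀ ≤ N → ∀ ε : ℝ,
        A * Real.log (Real.log (N : ℝ)) ^ (5 / 2 + δ) * Real.log (N : ℝ) ^ (-(1 / 2 : ℝ)) ≤ ε →
        ε ≤ 1 / 4 → ∀ τ : ℝ, |τ| ≤ (N : ℝ) ^ (3 / 4 : ℝ) →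
          ‖(riemannZeta (1 / 2 + ε + τ * I))⁻¹ - moebiusSum N (1 / 2 + ε + τ * I)‖ ≤
            K * (N : ℝ) ^ (-ε / 4) * (1 + |τ|) ^ (1 / 2 - betaExp τ) := by
  intro δ hδ hδ2
  set p : ℝ := 5 / 2 + δ with hpdef
  have hp0 : 0 ≤ p := by rw [hpdef]; linarith
  -- (A) ⇒ Prop. 11 on `[1, ∞)` with the majorant `G̃`
  obtain ⟨C_A, hC_A, hMA⟩ := hA δ hδ hδ2
  set C' : ℝ := max C_A 4 with hC'
  have hC'0 : 0 ≤ C' := le_trans (by norm_num) (le_max_right _ _)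
  set K₁ : ℝ := 2 * C' with hK₁
  have hK₁0 : 0 ≤ K₁ := by positivity
  have h11 : ∀ X : ℕ, 1 ≤ X → ∀ τ : ℝ,
      ‖moebiusSum X (τ * I)‖ ≤ K₁ * (1 + |τ|) * Real.sqrt X * gFun p (max X 16) :=
    fun X hX τ ↦ norm_moebiusSum_twist_le_of_mertens (G := fun t ↦ gFun p (max t 16)) hC'0
      (fun x _ ↦ zero_le_one.trans (one_le_gFun_max p x)) (gFun_max_monotoneOn hp0)
      (fun x hx ↦ abs_mertens_le_gFun_max hMA x hx) hX τ
  -- (P12) at `δ/6`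
  obtain ⟨N₁₂, K₁₂, hK₁₂, hP12⟩ := h12 (δ / 6) (by positivity) (by linarith)
  have hp6 : (5 / 2 + 6 * (δ / 6) : ℝ) = p := by rw [hpdef]; ring
  rw [hp6] at hP12
  set Nbig : ℕ := ⌈Real.exp (Real.exp (2 * p))⌉₊ with hNbig
  refine ⟨40, 2 * K₁₂ + 6 * K₁ + 1, max N₁₂ (max 16 Nbig), by norm_num, by positivity,
    fun N hN ε hεlow hε1 τ hτ ↦ ?_⟩
  ---- unpacking `N ≥ N₀`
  have hN12 : N₁₂ ≤ N := le_of_max_le_left hN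
  have hN16 : 16 ≤ N := le_of_max_le_left (le_of_max_le_right hN)
  have hNb : Nbig ≤ N := le_of_max_le_right (le_of_max_le_right hN)
  have hN16' : (16 : ℝ) ≤ N := by exact_mod_cast hN16
  have hN1 : 1 ≤ N := by omega
  have hN1' : (1 : ℝ) ≤ N := by exact_mod_cast hN1
  have hN0 : (0 : ℝ) < N := by linarith
  obtain ⟨hL1, hLL1⟩ := log_bounds_of_sixteen_le hN16'
  have hL0 : 0 < Real.log N := (Real.exp_pos 1).trans hL1
  have hbig : 2 * p ≤ Real.log (Real.log N) := by
    have h1 : Real.exp (Real.exp (2 * p)) ≤ N := (Nat.le_ceil _).trans (by exact_mod_cast hNb)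
    have h2 : Real.exp (2 * p) ≤ Real.log N := by
      rw [← Real.log_exp (Real.exp (2 * p))]; exact Real.log_le_log (Real.exp_pos _) h1
    rw [← Real.log_exp (2 * p)]; exact Real.log_le_log (Real.exp_pos _) h2
  ---- the threshold: `40 E ≤ ε log N`, `E = E_p(N) ≥ (log N)^{1/2} ≥ 1`
  set E : ℝ := eExp p N with hE
  have hE1 : Real.log N ^ (1 / 2 : ℝ) ≤ E :=
    le_mul_of_one_le_right (Real.rpow_nonneg hL0.le _) (Real.one_le_rpow hLL1.le hp0)
  have hsqrtL1 : 1 ≤ Real.log N ^ (1 / 2 : ℝ) :=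
    Real.one_le_rpow (by linarith [Real.add_one_le_exp (1 : ℝ)]) (by norm_num)
  have hE0 : 0 ≤ E := by linarith
  have hthr : 40 * (E / Real.log N) ≤ ε := by
    rw [hE, eExp_div_log_eq hL0, ← mul_assoc]; exact hεlow
  have hεE : 40 * E ≤ ε * Real.log N := by
    rw [mul_div_assoc', div_le_iff₀ hL0] at hthr; exact hthr
  have hε0 : 0 < ε := by
    have hEpos : 0 < E := lt_of_lt_of_le zero_lt_one (hsqrtL1.trans hE1)
    have : 0 < 40 * (E / Real.log N) := by have := div_pos hEpos hL0; linarith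
    linarith
  have hεN : ε⁻¹ ≤ (N : ℝ) ^ (ε / 6) := inv_eps_le_rpow hN0 hL0 hε0 hE1 hεE
  ---- `G̃(t) ≤ t^{ε/40}` for `t ≥ N`
  have hGle : ∀ t : ℝ, (N : ℝ) ≤ t → gFun p (max t 16) ≤ t ^ (ε / 40) := fun t ht ↦ by
    rw [max_eq_left (hN16'.trans ht)]
    exact gFun_le_rpow hp0 (by norm_num) hN16' hbig hthr ht
  have hGfl : ∀ t : ℝ, (N : ℝ) ≤ t → gFun p (max (⌊t⌋₊ : ℝ) 16) ≤ t ^ (ε / 6) := fun t ht ↦ by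
    have ht1 : 1 ≤ t := hN1'.trans ht
    have hf1 : (1 : ℝ) ≤ ⌊t⌋₊ := by exact_mod_cast Nat.le_floor (by exact_mod_cast ht1 : ((1 : ℕ) : ℝ) ≤ t)
    calc gFun p (max (⌊t⌋₊ : ℝ) 16) ≤ gFun p (max t 16) :=
          gFun_max_monotoneOn hp0 (Set.mem_Ici.mpr hf1) (Set.mem_Ici.mpr ht1) (Nat.floor_le (by linarith))
      _ ≤ t ^ (ε / 40) := hGle t ht
      _ ≤ t ^ (ε / 6) := Real.rpow_le_rpow_of_exponent_le ht1 (by linarith)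
  have hG4 : ∀ t : ℝ, (N : ℝ) ≤ t → gFun p (max t 16) ^ 4 ≤ t ^ (ε / 6) := fun t ht ↦ by
    have ht1 : 1 ≤ t := hN1'.trans ht
    calc gFun p (max t 16) ^ 4 ≤ (t ^ (ε / 40)) ^ 4 :=
          pow_le_pow_left₀ (zero_le_one.trans (one_le_gFun_max p t)) (hGle t ht) 4
      _ = t ^ (ε / 10) := by
          rw [← Real.rpow_natCast, ← Real.rpow_mul (by linarith)]; congr 1; push_cast; ring
      _ ≤ t ^ (ε / 6) := Real.rpow_le_rpow_of_exponent_le ht1 (by linarith)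
  ---- the dichotomy
  rcases le_or_gt |τ| (Real.exp (3 * E)) with hsmall | hlarge
  · -- small ordinates
    have h11pt : ∀ t : ℝ, (N : ℝ) ≤ t →
        ‖moebiusSum ⌊t⌋₊ (τ * I)‖ ≤ K₁ * (1 + |τ|) * Real.sqrt t * t ^ (ε / 6) := fun t ht ↦ by
      have ht0 : 0 ≤ t := by linarith
      have hf1 : 1 ≤ ⌊t⌋₊ := Nat.le_floor (by exact_mod_cast hN1'.trans ht)
      calc ‖moebiusSum ⌊t⌋₊ (τ * I)‖
          ≤ K₁ * (1 + |τ|) * Real.sqrt (⌊t⌋₊ : ℝ) * gFun p (max (⌊t⌋₊ : ℝ) 16) := h11 _ hf1 τ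
        _ ≤ K₁ * (1 + |τ|) * Real.sqrt t * t ^ (ε / 6) :=
            mul_le_mul (mul_le_mul_of_nonneg_left (Real.sqrt_le_sqrt (Nat.floor_le ht0)) (by positivity))
              (hGfl t ht) (zero_le_one.trans (one_le_gFun_max p _)) (by positivity)
    have hlogτ : Real.log (1 + |τ|) ≤ 4 * E := by
      have h1 : 1 + |τ| ≤ 2 * Real.exp (3 * E) := by
        have : 1 ≤ Real.exp (3 * E) := Real.one_le_exp (by positivity); linarith
      calc Real.log (1 + |τ|) ≤ Real.log (2 * Real.exp (3 * E)) := Real.log_le_log (by positivity) h1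
        _ = Real.log 2 + 3 * E := by rw [Real.log_mul (by norm_num) (Real.exp_pos _).ne', Real.log_exp]
        _ ≤ 4 * E := by
            have := Real.log_two_lt_d9
            have : (1 : ℝ) ≤ E := hsqrtL1.trans hE1
            linarith
    have h := small_case hRH hN1 hε0 hε1 hεN hK₁0 h11pt hE0 hlogτ hεE
    refine h.trans (mul_le_mul_of_nonneg_right (mul_le_mul_of_nonneg_right ?_
      (Real.rpow_nonneg hN0.le _)) (Real.rpow_nonneg (by positivity) _))
    nlinarith
  · -- large ordinates
    have hτ1 : 1 ≤ |τ| := le_trans (Real.one_le_exp (by positivity)) hlarge.le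
    have hτee : Real.exp (Real.exp (Real.exp 1)) ≤ |τ| := by
      refine le_trans (Real.exp_le_exp.mpr ?_) hlarge.le
      have h1 : Real.exp (2 * p) ≤ Real.log N := by
        rw [← Real.log_le_log_iff (Real.exp_pos _) hL0, Real.log_exp]; exact hbig
      have h2 : Real.exp p ≤ Real.log N ^ (1 / 2 : ℝ) := by
        have : Real.exp p = (Real.exp (2 * p)) ^ (1 / 2 : ℝ) := by
          rw [← Real.exp_mul]; congr 1; ring
        rw [this]; exact Real.rpow_le_rpow (Real.exp_pos _).le h1 (by norm_num)
      have he3 : Real.exp 1 < 3 := by have := Real.exp_one_lt_d9; linarith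
      have h3 : Real.exp (Real.exp 1) ≤ 3 * Real.exp p :=
        calc Real.exp (Real.exp 1) ≤ Real.exp (7 / 2) := Real.exp_le_exp.mpr (by linarith)
          _ = Real.exp (5 / 2) * Real.exp 1 := by rw [← Real.exp_add]; norm_num
          _ ≤ Real.exp (5 / 2) * 3 := by gcongr
          _ ≤ Real.exp p * 3 := by gcongr; rw [hpdef]; linarith
          _ = 3 * Real.exp p := by ring
      linarith [h2.trans hE1]
    have hLLτ : 0 < Real.log (Real.log |τ|) := by
      have h1 : Real.exp (Real.exp 1) ≤ Real.log |τ| := by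
        rw [← Real.log_exp (Real.exp (Real.exp 1))]; exact Real.log_le_log (Real.exp_pos _) hτee
      have h2 : Real.exp 1 ≤ Real.log (Real.log |τ|) := by
        rw [← Real.log_exp (Real.exp 1)]; exact Real.log_le_log (Real.exp_pos _) h1
      linarith [Real.exp_pos 1]
    set q : ℝ := |τ| ^ (1 / 2 - kappaExp τ) with hqdef
    have hq0 : 0 ≤ q := Real.rpow_nonneg (abs_nonneg τ) _
    have hq1 : 1 ≤ q := Real.one_le_rpow hτ1 (by linarith [kappaExp_le_half hLLτ])
    have hqQ : q ≤ (1 + |τ|) ^ (1 / 2 - betaExp τ) :=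
      calc q ≤ |τ| ^ (1 / 2 - betaExp τ) :=
            Real.rpow_le_rpow_of_exponent_le hτ1 (by linarith [betaExp_le_kappaExp hτee])
        _ ≤ (1 + |τ|) ^ (1 / 2 - betaExp τ) :=
            Real.rpow_le_rpow (abs_nonneg _) (by linarith) (by linarith [(betaExp_nonneg_le τ).2])
    have hUV : ∀ t : ℝ, (N : ℝ) ≤ t →
        ‖moebiusSum ⌊t⌋₊ (τ * I)‖ ≤ K₁₂ * q * Real.sqrt t + 2 * K₁ * Real.sqrt t * t ^ (ε / 6) :=
      fun t ht ↦ large_pointwise hp0 hN16 hK₁0 hK₁₂.le hq0 hτ1 hτ (h11 · · τ)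
        (fun X hX h1 h2 ↦ by simpa only [hqdef, mul_assoc] using hP12 X (hN12.trans hX) τ h1 h2) hG4 ht
    have hR := norm_inv_zeta_sub_moebiusSum_le hRH hN1 hε0 hε1 hεN τ (by positivity : 0 ≤ K₁₂ * q)
      (by positivity : 0 ≤ 2 * K₁) hUV
    exact large_final_algebra hK₁₂.le hK₁0 hR hq1 hqQ (Real.rpow_nonneg hN0.le _)
      (Real.rpow_le_rpow_of_exponent_le hN1' (by linarith))

end BalazardDeRoton
end Literature.NumberTheory.LFunctions

end
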